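import Summits.AtomisticToContinuum.FouriersLaw.Theorems.BondHeatUncertaintySubdiffusiveBondHeatJunctionRatioFirstBondBracket

/-!
# `JunctionRatioBracketCalculus` — file 22a: the OPERATOR piece [OPS] of the bracket identity [BI], part 1 — the commutators `[A_b, L]`, `[B_b, L]`
# (cell `decomp-a2c`, lens-1 «grading / quantitative ladder», gen 65; beneath file 19b; target 11071)

File 19b's leaf [BI] `FirstBondBracket` (`τ₁ − ½ = T·∫ Ψ_hot·g₀ dμ₀` and the cold mirror) splits (g64 `FirstBondBracketSkeleton.md`, critic rows
850/861) into [EXT] (Gibbs-side extension of the test class) ∧ [WL] (weak linearised stationarity equation) ∧ [OPS] (two operator identities and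
the pointwise bracket) ∧ [GIBBS] (one equilibrium identity) ∧ [LINK] (coefficient = `h`-moment).  Files 22a (this) and 22b
(`…JunctionRatioBracketPointwise`) PROVE [OPS] outright — for every `N`, every parameter value and every phase point; pure differential calculus
with the Literature generator `L = (pinnedChain ω₂ lam β γ).generator N T T`, no measure theory.  This part:

* the FIRST-ORDER COMMUTATOR of the generator with a constant vector field, at `fderiv` level, for a general chain with smooth potentials:
  `D_v(Lf) − L(D_v f) = Df·(DY·v)` (`fderiv_generator_apply`, `Y = drift`: the second-order part of `L` has constant coefficients, so only
  the drift is differentiated), whence for the pinned chain `∂_{p_b}(Lf) − L(∂_{p_b}f) = ∂_{q_b}f − γB_b∂_{p_b}f` and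
  `∂_{q_b}(Lf) − L(∂_{q_b}f) = −Σ_i Hess_{ib}(q) ∂_{p_i}f` (`partialP_generator_sub`, `partialQ_generator_sub`; `B_b = bathWeight N b`,
  `Hess = hessPotential`, via the Literature lemmas `pinnedChain_fderiv_drift_unitP/unitQ`);
* the Leibniz rule `L(mf) = m·Lf + f·Lm + 2γ Σ_i T_i ∂_{p_i}m ∂_{p_i}f` (`generator_mul_fun`), `L p_b = −∂_{q_b}H − γB_b p_b`
  (`generator_coord_snd`), `L(g∘q) = Σ_i p_i ∂_{q_i}(g∘q)` (`generator_comp_fst`), `∂_{q_i}(∂_{q_b}Φ ∘ q) = Hess_{ib}`;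
* `adjointP T b φ = p_b φ/T − ∂_{p_b}φ` (`A_b`, the formal `μ_T`-adjoint of `∂_{p_b}`: the shape of the right-hand side of `IsTapScoreAt`) and
  `adjointQ P T b φ = (∂_{q_b}H) φ/T − ∂_{q_b}φ` (`B_b`, the formal `μ_T`-adjoint of `∂_{q_b}`) [notions · explicit], and the two commutators
  **(C1)** `A_b(Lf) − L(A_b f) = B_b f + γB_b·A_b f` (`adjointP_generator_comm`; `T ≠ 0`; the carré-du-champ term `2γT_b∂_{p_b}f/T` is where
  `T_L = T_R = T` enters) and **(C2)** `B_b(Lf) − L(B_b f) = −Σ_i Hess_{ib} A_i f` (`adjointQ_generator_comm`, any `T`), for `f ∈ C³`.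

Part 2 (file 22b) turns (C1) ∧ (C2) into the pointwise identity `p_j²/T − 1 = A_b Ψ − L(A_b(Lψ) + B_b ψ)` for the transfer observable `Ψ` of 19b.
FIXED-`N`; fully proved; standard axioms; imports only file 19b (independent of files 21a–21f).
-/

noncomputable section

open MeasureTheory Filter Topology Set
open scoped BigOperators ContDiff

namespace Summit.AtomisticToContinuum.FouriersLaw.Theorems.SubdiffusiveBondHeat

namespace EscapeGrading

open Literature.MathematicalPhysics.KineticTheory.HeatConduction

variable {N : ℕ}

/-! ## A. Directional derivatives along constant vectors -/

/-- `D_v (y ↦ Dg(y) w) (x) = D²g(x)(v)(w)` for `g ∈ C²`. [calculus] -/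
theorem fderiv_fderiv_apply_const {g : PhaseSpace N → ℝ} (hg : ContDiff ℝ 2 g) (x v w : PhaseSpace N) :
    fderiv ℝ (fun y => fderiv ℝ g y w) x v = fderiv ℝ (fderiv ℝ g) x v w := by
  have hd : DifferentiableAt ℝ (fderiv ℝ g) x :=
    ((hg.fderiv_right (m := 1) (by norm_num)).differentiable (by norm_num)) x
  rw [fderiv_clm_apply hd (differentiableAt_const w)]
  simp

/-- Directional derivatives along two constant vectors commute on `C²` functions (Schwarz). [calculus] -/
theorem fderiv_apply_comm {g : PhaseSpace N → ℝ} (hg : ContDiff ℝ 2 g) (x v w : PhaseSpace N) :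
    fderiv ℝ (fun y => fderiv ℝ g y w) x v = fderiv ℝ (fun y => fderiv ℝ g y v) x w := by
  rw [fderiv_fderiv_apply_const hg, fderiv_fderiv_apply_const hg, fderiv_fderiv_symm hg x v w]

/-- `y ↦ Dg(y) v` is `C^m` when `g ∈ C^n`, `m + 1 ≤ n`. [calculus] -/
theorem contDiff_fderiv_apply_const {g : PhaseSpace N → ℝ} {m n : WithTop ℕ∞} (hg : ContDiff ℝ n g)
    (hmn : m + 1 ≤ n) (v : PhaseSpace N) : ContDiff ℝ m (fun y => fderiv ℝ g y v) :=
  (hg.fderiv_right hmn).clm_apply contDiff_const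

/-- `∂²_{p_i} g = D_{e_i} D_{e_i} g` (`e_i = (0, δ_i)`) as functions, for `g ∈ C²`. [calculus] -/
theorem partialP_partialP_eq_fderiv {g : PhaseSpace N → ℝ} (hg : ContDiff ℝ 2 g) (i : Fin N) :
    partialP i (partialP i g) = fun y => fderiv ℝ (fun z => fderiv ℝ g z (unitP i)) y (unitP i) := by
  have hgd : Differentiable ℝ g := hg.differentiable (by norm_num)
  rw [partialP_eq_fderiv hgd i, unitP_eq]
  exact partialP_eq_fderiv ((contDiff_fderiv_apply_const hg (m := 1) (by norm_num) _).differentiable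
    (by norm_num)) i

/-! ## B. The generator on `C³` functions: closed form, regularity, and the derivative commutator -/

/-- Closed form of the generator on a `C²` function, all derivatives written as Fréchet derivatives:
`L f = Df·Y + γ Σ_i c_i D_{e_i}D_{e_i} f`, `c_i = T_L[i = 0] + T_R[i = N−1]`. [calculus] -/
theorem generator_eq_fderiv_form (P : OscillatorChain) (T_L T_R : ℝ) {f : PhaseSpace N → ℝ}
    (hf : ContDiff ℝ 2 f) :
    P.generator N T_L T_R f = fun y => fderiv ℝ f y (P.drift N y) +
      P.γ * ∑ i, ((if i.val = 0 then T_L else 0) + (if i.val = N - 1 then T_R else 0)) *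
        fderiv ℝ (fun z => fderiv ℝ f z (unitP i)) y (unitP i) := by
  funext y
  rw [P.generator_eq_fderiv_drift_add N T_L T_R (hf.differentiable (by norm_num)) y]
  simp only [partialP_partialP_eq_fderiv hf]

/-- **Regularity of the generator**: `f ∈ C^n`, `m + 2 ≤ n`, smooth potentials ⇒ `L f ∈ C^m`. [calculus] -/
theorem contDiff_generator_of_contDiff (P : OscillatorChain) (hU : ContDiff ℝ ∞ P.U) (hV : ContDiff ℝ ∞ P.V)
    (T_L T_R : ℝ) {f : PhaseSpace N → ℝ} {m : ℕ∞} {n : WithTop ℕ∞} (hf : ContDiff ℝ n f)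
    (hmn : (m : WithTop ℕ∞) + 2 ≤ n) : ContDiff ℝ m (P.generator N T_L T_R f) := by
  have h2 : (2 : WithTop ℕ∞) ≤ n := le_trans le_add_self hmn
  have hm1 : (m : WithTop ℕ∞) + 1 + 1 ≤ n := by rwa [add_assoc, one_add_one_eq_two]
  have hm : (m : WithTop ℕ∞) ≤ m + 1 := le_self_add
  have hmt : (m : WithTop ℕ∞) ≤ ∞ := WithTop.coe_le_coe.mpr le_top
  rw [generator_eq_fderiv_form P T_L T_R (hf.of_le h2)]
  refine ContDiff.add ?_ (contDiff_const.mul (ContDiff.sum fun i _ => contDiff_const.mul ?_))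
  · exact ((hf.fderiv_right hm1).of_le hm).clm_apply ((P.contDiff_drift hU hV N).of_le hmt)
  · exact contDiff_fderiv_apply_const (contDiff_fderiv_apply_const hf hm1 _) le_rfl _

/-- **The derivative commutator.** For `f ∈ C³` and a constant vector `v`:
`D_v (L f) − L (D_v f) = Df · (DY v)` — the second-order (bath) part commutes with constant-coefficient
derivatives, the transport part leaves the Jacobian `DY` of the drift. [calculus] -/
theorem fderiv_generator_apply (P : OscillatorChain) (hU : ContDiff ℝ ∞ P.U) (hV : ContDiff ℝ ∞ P.V)
    (T_L T_R : ℝ) {f : PhaseSpace N → ℝ} (hf : ContDiff ℝ 3 f) (x v : PhaseSpace N) :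
    fderiv ℝ (P.generator N T_L T_R f) x v =
      P.generator N T_L T_R (fun y => fderiv ℝ f y v) x + fderiv ℝ f x (fderiv ℝ (P.drift N) x v) := by
  have hf2 : ContDiff ℝ 2 f := hf.of_le (by norm_num)
  have h1 : ∀ w, ContDiff ℝ 2 (fun y => fderiv ℝ f y w) := fun w =>
    contDiff_fderiv_apply_const hf (by norm_num) w
  have h2d : ∀ w w', Differentiable ℝ (fun y => fderiv ℝ (fun z => fderiv ℝ f z w) y w') := fun w w' =>
    (contDiff_fderiv_apply_const (h1 w) (m := 1) (by norm_num) w').differentiable (by norm_num)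
  -- derivative of the closed form
  have hY : HasFDerivAt (P.drift N) (fderiv ℝ (P.drift N) x) x :=
    (((P.contDiff_drift hU hV N).differentiable (by simp)) x).hasFDerivAt
  have hDf : HasFDerivAt (fderiv ℝ f) (fderiv ℝ (fderiv ℝ f) x) x :=
    (((hf.fderiv_right (m := 2) (by norm_num)).differentiable (by norm_num)) x).hasFDerivAt
  have hA := hDf.clm_apply hY
  have hB : HasFDerivAt (fun y => P.γ * ∑ i, ((if i.val = 0 then T_L else 0) + (if i.val = N - 1 then T_R else 0)) *
        fderiv ℝ (fun z => fderiv ℝ f z (unitP i)) y (unitP i))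
      (P.γ • ∑ i, ((if i.val = 0 then T_L else 0) + (if i.val = N - 1 then T_R else 0)) •
        fderiv ℝ (fun y => fderiv ℝ (fun z => fderiv ℝ f z (unitP i)) y (unitP i)) x) x :=
    (HasFDerivAt.fun_sum fun i _ =>
      (((h2d (unitP i) (unitP i)) x).hasFDerivAt.const_mul _)).const_mul P.γ
  rw [generator_eq_fderiv_form P T_L T_R hf2, (hA.fun_add hB).fderiv, generator_eq_fderiv_form P T_L T_R (h1 v)]
  simp only [_root_.add_apply, ContinuousLinearMap.comp_apply, ContinuousLinearMap.flip_apply,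
    _root_.smul_apply, FunLike.coe_sum, Finset.sum_apply, smul_eq_mul]
  -- second-order term: symmetry of `D²f`
  have e2 : fderiv ℝ (fun y => fderiv ℝ f y v) x (P.drift N x) = fderiv ℝ (fderiv ℝ f) x v (P.drift N x) := by
    rw [fderiv_fderiv_apply_const hf2, fderiv_fderiv_symm hf2 x (P.drift N x) v]
  -- third-order terms: two commutations of directional derivatives
  have e3 : ∀ i, fderiv ℝ (fun y => fderiv ℝ (fun z => fderiv ℝ f z (unitP i)) y (unitP i)) x v =
      fderiv ℝ (fun z => fderiv ℝ (fun y => fderiv ℝ f y v) z (unitP i)) x (unitP i) := by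
    intro i
    rw [fderiv_apply_comm (h1 (unitP i)) x v (unitP i)]
    have : (fun y => fderiv ℝ (fun z => fderiv ℝ f z (unitP i)) y v) =
        fun z => fderiv ℝ (fun y => fderiv ℝ f y v) z (unitP i) :=
      funext fun y => fderiv_apply_comm hf2 y v (unitP i)
    rw [this]
  rw [e2]
  simp only [e3]
  ring

/-- `∂_{p_b}(L f) − L(∂_{p_b} f) = ∂_{q_b} f − γ B_b ∂_{p_b} f` for the pinned chain (`f ∈ C³`):
the derivative commutator at `v = (0, e_b)`, `DY(0, e_b) = (e_b, 0) − γB_b (0, e_b)`. [calculus] -/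
theorem partialP_generator_sub (ω₂ lam β γ T_L T_R : ℝ) {f : PhaseSpace N → ℝ} (hf : ContDiff ℝ 3 f)
    (b : Fin N) (x : PhaseSpace N) :
    partialP b ((pinnedChain ω₂ lam β γ).generator N T_L T_R f) x
        - (pinnedChain ω₂ lam β γ).generator N T_L T_R (partialP b f) x =
      partialQ b f x - γ * OscillatorChain.bathWeight N b * partialP b f x := by
  have hU := pinnedChain_contDiff_U ω₂ lam β γ (n := ∞)
  have hV := pinnedChain_contDiff_V ω₂ lam β γ (n := ∞)
  have hfd : Differentiable ℝ f := hf.differentiable (by norm_num)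
  have hLd : Differentiable ℝ ((pinnedChain ω₂ lam β γ).generator N T_L T_R f) :=
    (contDiff_generator_of_contDiff _ hU hV T_L T_R hf (m := 1) (by norm_num)).differentiable (by norm_num)
  rw [partialP_eq_fderiv hLd b, partialP_eq_fderiv hfd b, partialQ_eq_fderiv hfd b]
  beta_reduce
  rw [← unitP_eq, ← unitQ_eq, fderiv_generator_apply _ hU hV T_L T_R hf x (unitP b),
    pinnedChain_fderiv_drift_unitP, map_sub, map_smul, smul_eq_mul]
  ring

/-- `∂_{q_b}(L f) − L(∂_{q_b} f) = −Σ_i (∂²Φ/∂q_i∂q_b) ∂_{p_i} f` for the pinned chain (`f ∈ C³`):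
the derivative commutator at `v = (e_b, 0)`, `DY(e_b, 0) = −Σ_i Hess_{ib} (0, e_i)`. [calculus] -/
theorem partialQ_generator_sub (ω₂ lam β γ T_L T_R : ℝ) {f : PhaseSpace N → ℝ} (hf : ContDiff ℝ 3 f)
    (b : Fin N) (x : PhaseSpace N) :
    partialQ b ((pinnedChain ω₂ lam β γ).generator N T_L T_R f) x
        - (pinnedChain ω₂ lam β γ).generator N T_L T_R (partialQ b f) x =
      -∑ i, (pinnedChain ω₂ lam β γ).hessPotential N i b x.1 * partialP i f x := by
  have hU := pinnedChain_contDiff_U ω₂ lam β γ (n := ∞)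
  have hV := pinnedChain_contDiff_V ω₂ lam β γ (n := ∞)
  have hfd : Differentiable ℝ f := hf.differentiable (by norm_num)
  have hLd : Differentiable ℝ ((pinnedChain ω₂ lam β γ).generator N T_L T_R f) :=
    (contDiff_generator_of_contDiff _ hU hV T_L T_R hf (m := 1) (by norm_num)).differentiable (by norm_num)
  rw [partialQ_eq_fderiv hLd b, partialQ_eq_fderiv hfd b]
  simp only [partialP_eq_fderiv hfd]
  rw [← unitQ_eq, fderiv_generator_apply _ hU hV T_L T_R hf x (unitQ b),
    pinnedChain_fderiv_drift_unitQ, map_neg, map_sum]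
  simp only [map_smul, smul_eq_mul, unitP_eq]
  ring


/-! ## C. Leibniz rules: the generator on products, on a momentum coordinate and on position functions -/

open Summit.AtomisticToContinuum.FouriersLaw.Theorems.SuperadditiveResistance.DeviceLiouville
  (partialP_sub partialQ_sub differentiable_partialP_of_contDiff_two)
open Summit.AtomisticToContinuum.FouriersLaw.Cruxes.SuperadditiveResistance.InsertionToolbox
  (partialP_snd partialQ_snd partialP_fst partialQ_fst)
open Summit.AtomisticToContinuum.FouriersLaw.Theorems.OddSectorIrreversibility
  (generator_add generator_const_mul)

/-- `∂²_{p_i}(m f) = m ∂²_{p_i}f + 2 ∂_{p_i}m ∂_{p_i}f + f ∂²_{p_i}m` for `m, f ∈ C²`. [calculus] -/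
theorem partialP_partialP_mul_fun {m f : PhaseSpace N → ℝ} (hm : ContDiff ℝ 2 m) (hf : ContDiff ℝ 2 f)
    (i : Fin N) (x : PhaseSpace N) :
    partialP i (partialP i (fun y => m y * f y)) x =
      m x * partialP i (partialP i f) x + 2 * (partialP i m x * partialP i f x) +
        f x * partialP i (partialP i m) x := by
  have hmd : Differentiable ℝ m := hm.differentiable (by norm_num)
  have hfd : Differentiable ℝ f := hf.differentiable (by norm_num)
  have hm1 := differentiable_partialP_of_contDiff_two hm i
  have hf1 := differentiable_partialP_of_contDiff_two hf i
  have h1 : partialP i (fun y => m y * f y) = m * partialP i f + f * partialP i m := by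
    funext y
    exact partialP_mul hmd hfd i y
  rw [h1, partialP_add (hmd.mul hf1) (hfd.mul hm1), partialP_mul hmd hf1, partialP_mul hfd hm1]
  ring

/-- **Leibniz rule for the generator** (carré du champ): for `m, f ∈ C²`,
`L(m f) = m·Lf + f·Lm + 2γ Σ_i (T_L[i=0] + T_R[i=N−1]) ∂_{p_i}m ∂_{p_i}f`. [calculus] -/
theorem generator_mul_fun (P : OscillatorChain) (T_L T_R : ℝ) {m f : PhaseSpace N → ℝ}
    (hm : ContDiff ℝ 2 m) (hf : ContDiff ℝ 2 f) (x : PhaseSpace N) :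
    P.generator N T_L T_R (fun y => m y * f y) x =
      m x * P.generator N T_L T_R f x + f x * P.generator N T_L T_R m x +
        2 * P.γ * ∑ i, ((if i.val = 0 then T_L else 0) + (if i.val = N - 1 then T_R else 0)) *
          (partialP i m x * partialP i f x) := by
  have hmd : Differentiable ℝ m := hm.differentiable (by norm_num)
  have hfd : Differentiable ℝ f := hf.differentiable (by norm_num)
  have e1 : ∀ i, partialQ i (fun y => m y * f y) x = m x * partialQ i f x + f x * partialQ i m x :=
    fun i => partialQ_mul hmd hfd i x
  have e2 : ∀ i, partialP i (fun y => m y * f y) x = m x * partialP i f x + f x * partialP i m x :=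
    fun i => partialP_mul hmd hfd i x
  unfold OscillatorChain.generator
  simp only [e1, e2, partialP_partialP_mul_fun hm hf]
  simp only [Finset.mul_sum, mul_add, ← Finset.sum_add_distrib]
  refine Finset.sum_congr rfl fun i _ => ?_
  split_ifs <;> ring

/-- The generator on a momentum coordinate: `L p_b = −∂_{q_b}H − γ B_b p_b` (`B_b = bathWeight N b`). [calculus] -/
theorem generator_coord_snd (P : OscillatorChain) (T_L T_R : ℝ) (b : Fin N) (x : PhaseSpace N) :
    P.generator N T_L T_R (fun y => y.2 b) x =
      -partialQ b (P.hamiltonian N) x - P.γ * OscillatorChain.bathWeight N b * x.2 b := by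
  have h2 : ∀ i, partialP i (partialP i (fun y : PhaseSpace N => y.2 b)) x = 0 := by
    intro i
    rw [show partialP i (fun y : PhaseSpace N => y.2 b) = fun _ => (if b = i then (1 : ℝ) else 0) from
      funext fun z => partialP_snd i b z]
    simp [partialP]
  unfold OscillatorChain.generator
  simp only [partialQ_snd, partialP_snd, h2]
  rw [Finset.sum_eq_single b (fun i _ hib => by simp [Ne.symm hib]) (fun h => absurd (Finset.mem_univ b) h),
    Finset.sum_eq_single b (fun i _ hib => by simp [Ne.symm hib]) (fun h => absurd (Finset.mem_univ b) h)]
  simp only [if_true, OscillatorChain.bathWeight]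
  split_ifs <;> ring

/-- The generator on a function of the positions only: `L(g ∘ q) = Σ_i p_i ∂_{q_i}(g ∘ q)` (the bath part and the
force part do not see it). [calculus] -/
theorem generator_comp_fst (P : OscillatorChain) (T_L T_R : ℝ) (g : (Fin N → ℝ) → ℝ) (x : PhaseSpace N) :
    P.generator N T_L T_R (fun y => g y.1) x = ∑ i, x.2 i * partialQ i (fun y : PhaseSpace N => g y.1) x := by
  unfold OscillatorChain.generator
  simp [partialP]

/-- `∂_{q_i}` of the position function `y ↦ ∂_{q_b}Φ(y.1)` of the pinned chain is the Hessian entry `Hess_{ib}`.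
[calculus] -/
theorem partialQ_dPotential_comp_fst (ω₂ lam β γ : ℝ) (b i : Fin N) (x : PhaseSpace N) :
    partialQ i (fun y : PhaseSpace N => (pinnedChain ω₂ lam β γ).dPotential N b y.1) x =
      (pinnedChain ω₂ lam β γ).hessPotential N i b x.1 := by
  have hU2 : Differentiable ℝ (deriv (pinnedChain ω₂ lam β γ).U) := by
    rw [show deriv (pinnedChain ω₂ lam β γ).U = fun q => ω₂ * q + lam * q ^ 3 from
      funext (pinnedChain_deriv_U ω₂ lam β γ)]
    fun_prop
  have hV2 : Differentiable ℝ (deriv (pinnedChain ω₂ lam β γ).V) := by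
    rw [show deriv (pinnedChain ω₂ lam β γ).V = fun r => r + β * r ^ 3 from
      funext (pinnedChain_deriv_V ω₂ lam β γ)]
    fun_prop
  have h0 := (pinnedChain ω₂ lam β γ).hasDerivAt_dPotential_add_smul hU2 hV2 N x.1 b i
  have hfun : (fun t => (pinnedChain ω₂ lam β γ).dPotential N b (Function.update x.1 i t)) =
      (fun s => (pinnedChain ω₂ lam β γ).dPotential N b (x.1 + s • Pi.single i 1)) ∘ fun t => t - x.1 i := by
    funext t
    simp only [Function.comp_apply, add_smul_single_eq_update, add_sub_cancel]
  have hlin : HasDerivAt (fun t : ℝ => t - x.1 i) 1 (x.1 i) := (hasDerivAt_id (x.1 i)).sub_const (x.1 i)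
  have key : HasDerivAt (fun t => (pinnedChain ω₂ lam β γ).dPotential N b (Function.update x.1 i t))
      ((pinnedChain ω₂ lam β γ).hessPotential N b i x.1) (x.1 i) := by
    rw [hfun]
    simpa using h0.comp_of_eq (x.1 i) hlin (by simp)
  show deriv (fun t => (pinnedChain ω₂ lam β γ).dPotential N b (Function.update x.1 i t)) (x.1 i) = _
  rw [key.deriv, (pinnedChain ω₂ lam β γ).hessPotential_comm N b i x.1]

/-! ## D. The `μ_T`-adjoint derivatives `A_b = ∂*_{p_b}`, `B_b = ∂*_{q_b}` and their commutators with `L_T`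

For the Gibbs measure `μ_T ∝ e^{−H/T}`, integration by parts reads `∫ (∂_{p_b}φ) χ dμ_T = ∫ φ (A_b χ) dμ_T`
with `A_b χ = p_b χ/T − ∂_{p_b}χ` (this is exactly the shape of the right-hand side of `IsTapScoreAt`), and
`∫ (∂_{q_b}φ) χ dμ_T = ∫ φ (B_b χ) dμ_T` with `B_b χ = (∂_{q_b}H) χ/T − ∂_{q_b}χ`.  The two commutator
identities below are the pointwise (measure-free) content of `[∂_{p_b}, L†]` and `[∂_{q_b}, L†]` for the
equal-temperature generator `L = L_{T,T}` of the pinned chain. -/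

/-- `A_b φ = p_b φ / T − ∂_{p_b} φ`, the formal `μ_T`-adjoint of `∂_{p_b}`. [notion · explicit] -/
def adjointP (T : ℝ) (b : Fin N) (φ : PhaseSpace N → ℝ) (x : PhaseSpace N) : ℝ :=
  x.2 b / T * φ x - partialP b φ x

/-- `B_b φ = (∂_{q_b}H) φ / T − ∂_{q_b} φ`, the formal `μ_T`-adjoint of `∂_{q_b}`. [notion · explicit] -/
def adjointQ (P : OscillatorChain) (T : ℝ) (b : Fin N) (φ : PhaseSpace N → ℝ) (x : PhaseSpace N) : ℝ :=
  partialQ b (P.hamiltonian N) x / T * φ x - partialQ b φ x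

/-- `A_b φ` as a linear combination of `p_b φ` and `∂_{p_b}φ` (function level). [bookkeeping] -/
theorem adjointP_eq_fun (T : ℝ) (b : Fin N) (φ : PhaseSpace N → ℝ) :
    adjointP T b φ = fun y => T⁻¹ * (y.2 b * φ y) + (-1 : ℝ) * partialP b φ y := by
  funext y
  simp only [adjointP]
  ring

/-- `B_b φ` as a linear combination of `(∂_{q_b}H) φ` and `∂_{q_b}φ` (function level). [bookkeeping] -/
theorem adjointQ_eq_fun (P : OscillatorChain) (T : ℝ) (b : Fin N) (φ : PhaseSpace N → ℝ) :
    adjointQ P T b φ = fun y => T⁻¹ * (partialQ b (P.hamiltonian N) y * φ y) + (-1 : ℝ) * partialQ b φ y := by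
  funext y
  simp only [adjointQ]
  ring

/-- `A_b φ ∈ C^m` for `φ ∈ C^n`, `m + 1 ≤ n`. [calculus] -/
theorem contDiff_adjointP {φ : PhaseSpace N → ℝ} {m n : WithTop ℕ∞} (hφ : ContDiff ℝ n φ) (hmn : m + 1 ≤ n)
    (T : ℝ) (b : Fin N) : ContDiff ℝ m (adjointP T b φ) := by
  have hφm : ContDiff ℝ m φ := hφ.of_le (le_trans le_self_add hmn)
  unfold adjointP
  exact ((((contDiff_apply ℝ ℝ b).comp contDiff_snd).div_const T).mul hφm).sub (contDiff_partialP hφ hmn b)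

/-- `B_b φ ∈ C^m` for `φ ∈ C^n`, `m + 1 ≤ n`, for the pinned chain (whose `∂_{q_b}H` is smooth). [calculus] -/
theorem contDiff_adjointQ (ω₂ lam β γ : ℝ) {φ : PhaseSpace N → ℝ} {m n : WithTop ℕ∞} (hφ : ContDiff ℝ n φ)
    (hmn : m + 1 ≤ n) (T : ℝ) (b : Fin N) : ContDiff ℝ m (adjointQ (pinnedChain ω₂ lam β γ) T b φ) := by
  have hφm : ContDiff ℝ m φ := hφ.of_le (le_trans le_self_add hmn)
  have hH : ContDiff ℝ (m + 1) ((pinnedChain ω₂ lam β γ).hamiltonian N) :=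
    (pinnedChain ω₂ lam β γ).contDiff_hamiltonian (pinnedChain_contDiff_U ω₂ lam β γ)
      (pinnedChain_contDiff_V ω₂ lam β γ) N
  unfold adjointQ
  exact (((contDiff_partialQ hH le_rfl b).div_const T).mul hφm).sub (contDiff_partialQ hφ hmn b)

/-- **(C1) momentum commutator.** For the equal-temperature generator `L = L_{T,T}` of the pinned chain
(`T ≠ 0`) and `f ∈ C³`:  `A_b(Lf) − L(A_b f) = B_b f + γ B_b A_b f`.
(The `T_b/T = 1` cancellation of the carré-du-champ term is where `T_L = T_R = T` is used.) [calculus] -/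
theorem adjointP_generator_comm (ω₂ lam β γ : ℝ) {T : ℝ} (hT : T ≠ 0) {f : PhaseSpace N → ℝ}
    (hf : ContDiff ℝ 3 f) (b : Fin N) (x : PhaseSpace N) :
    adjointP T b ((pinnedChain ω₂ lam β γ).generator N T T f) x
        - (pinnedChain ω₂ lam β γ).generator N T T (adjointP T b f) x =
      adjointQ (pinnedChain ω₂ lam β γ) T b f x
        + γ * OscillatorChain.bathWeight N b * adjointP T b f x := by
  have hf2 : ContDiff ℝ 2 f := hf.of_le (by norm_num)
  have hpb : ContDiff ℝ 2 (fun y : PhaseSpace N => y.2 b) := (contDiff_apply ℝ ℝ b).comp contDiff_snd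
  have hdf : ContDiff ℝ 2 (partialP b f) := contDiff_partialP hf (by norm_num) b
  have hc1 : ContDiff ℝ 2 (fun y : PhaseSpace N => T⁻¹ * (y.2 b * f y)) := contDiff_const.mul (hpb.mul hf2)
  have hc2 : ContDiff ℝ 2 (fun y : PhaseSpace N => (-1 : ℝ) * partialP b f y) := contDiff_const.mul hdf
  have hγ : (pinnedChain ω₂ lam β γ).γ = γ := rfl
  have hP' := partialP_generator_sub ω₂ lam β γ T T hf b x
  rw [sub_eq_iff_eq_add] at hP'
  rw [adjointP_eq_fun T b f]
  simp only [adjointP, adjointQ]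
  rw [generator_add _ N T T hc1 hc2 x, generator_const_mul, generator_const_mul,
    generator_mul_fun _ T T hpb hf2 x, generator_coord_snd _ T T b x, hP', hγ]
  simp only [partialP_snd]
  rw [Finset.sum_eq_single b (fun i _ hib => by simp [Ne.symm hib]) (fun h => absurd (Finset.mem_univ b) h)]
  simp only [if_true, OscillatorChain.bathWeight]
  split_ifs <;> field_simp <;> ring

/-- **(C2) position commutator.** For the generator `L = L_{T,T}` of the pinned chain and `f ∈ C³`:
`B_b(Lf) − L(B_b f) = −Σ_i Hess_{ib}(q) A_i f` (any `T`). [calculus] -/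
theorem adjointQ_generator_comm (ω₂ lam β γ T : ℝ) {f : PhaseSpace N → ℝ} (hf : ContDiff ℝ 3 f)
    (b : Fin N) (x : PhaseSpace N) :
    adjointQ (pinnedChain ω₂ lam β γ) T b ((pinnedChain ω₂ lam β γ).generator N T T f) x
        - (pinnedChain ω₂ lam β γ).generator N T T (adjointQ (pinnedChain ω₂ lam β γ) T b f) x =
      -∑ i, (pinnedChain ω₂ lam β γ).hessPotential N i b x.1 * adjointP T i f x := by
  have hf2 : ContDiff ℝ 2 f := hf.of_le (by norm_num)
  have hdf : ContDiff ℝ 2 (partialQ b f) := contDiff_partialQ hf (by norm_num) b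
  have hUd : Differentiable ℝ (pinnedChain ω₂ lam β γ).U :=
    (pinnedChain_contDiff_U ω₂ lam β γ (n := 1)).differentiable one_ne_zero
  have hVd : Differentiable ℝ (pinnedChain ω₂ lam β γ).V :=
    (pinnedChain_contDiff_V ω₂ lam β γ (n := 1)).differentiable one_ne_zero
  have hHb : partialQ b ((pinnedChain ω₂ lam β γ).hamiltonian N) =
      fun y => (pinnedChain ω₂ lam β γ).dPotential N b y.1 :=
    funext fun y => (pinnedChain ω₂ lam β γ).partialQ_hamiltonian_eq_dPotential hUd hVd N y b
  have hm : ContDiff ℝ 2 (fun y : PhaseSpace N => (pinnedChain ω₂ lam β γ).dPotential N b y.1) := by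
    have h3 : ContDiff ℝ 3 ((pinnedChain ω₂ lam β γ).hamiltonian N) :=
      (pinnedChain ω₂ lam β γ).contDiff_hamiltonian (pinnedChain_contDiff_U ω₂ lam β γ)
        (pinnedChain_contDiff_V ω₂ lam β γ) N
    have h2 := contDiff_partialQ h3 (by norm_num : (2 : WithTop ℕ∞) + 1 ≤ 3) b
    rwa [hHb] at h2
  have hc1 : ContDiff ℝ 2 (fun y : PhaseSpace N => T⁻¹ * ((pinnedChain ω₂ lam β γ).dPotential N b y.1 * f y)) :=
    contDiff_const.mul (hm.mul hf2)
  have hc2 : ContDiff ℝ 2 (fun y : PhaseSpace N => (-1 : ℝ) * partialQ b f y) := contDiff_const.mul hdf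
  have hp0 : ∀ i, partialP i (fun y : PhaseSpace N => (pinnedChain ω₂ lam β γ).dPotential N b y.1) x = 0 :=
    fun i => by simp [partialP]
  have hQ' := partialQ_generator_sub ω₂ lam β γ T T hf b x
  rw [sub_eq_iff_eq_add] at hQ'
  rw [adjointQ_eq_fun _ T b f]
  simp only [adjointQ, adjointP, hHb]
  rw [generator_add _ N T T hc1 hc2 x, generator_const_mul, generator_const_mul,
    generator_mul_fun _ T T hm hf2 x, generator_comp_fst _ T T ((pinnedChain ω₂ lam β γ).dPotential N b) x, hQ']
  simp only [hp0, partialQ_dPotential_comp_fst]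
  have hR : ∑ i, (pinnedChain ω₂ lam β γ).hessPotential N i b x.1 * (x.2 i / T * f x - partialP i f x) =
      f x / T * ∑ i, x.2 i * (pinnedChain ω₂ lam β γ).hessPotential N i b x.1
        - ∑ i, (pinnedChain ω₂ lam β γ).hessPotential N i b x.1 * partialP i f x := by
    rw [Finset.mul_sum, ← Finset.sum_sub_distrib]
    exact Finset.sum_congr rfl fun i _ => by ring
  rw [hR]
  simp only [zero_mul, mul_zero, Finset.sum_const_zero]
  ring

end EscapeGrading

end Summit.AtomisticToContinuum.FouriersLaw.Theorems.SubdiffusiveBondHeat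

end
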